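import Summits.BirchSwinnertonDyer.BirchSwinnertonDyer.Theorems.TameQuarticSolventSolventPairLowerBoundStubGoodReduction
import Literature.NumberTheory.Automorphic.SolvableBaseChangeModularityProofs
import Literature.NumberTheory.EllipticCurves.CongruentNumberCurveSupersingular
import Literature.NumberTheory.EllipticCurves.MinimalModelReduction
import Literature.NumberTheory.EllipticCurves.HasseWeilGoodReduction
import Literature.NumberTheory.EllipticCurves.HasseWeilGoodReductionFrobenius
import Literature.RingTheory.DiscreteValuationRing.AdicCompletionResidueField
import Mathlib.NumberTheory.RamificationInertia.Basic
import HarnessLib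

/-!
# Route `TameQuarticSolvent`, crux `SolventPairLowerBound` (stmt-BirchSwinnertonDyer-21391), line `birth`:
# the BC5 rung completed — a (t′)-at-`3` curve has SUPERSINGULAR good reduction with `a_w = 0` at every
# place `w ∣ 3` with `e(w|3) = 4` and odd residue degree (e.g. the unique place above `3` of a quartic
# field totally ramified at `3`)

HONEST FRAMING. Theorems only; helper toward the deciding crux `SolventPairLowerBound` of route
`TameQuarticSolvent` (`--supports stmt-BirchSwinnertonDyer-21391`), sharpening the landed stub
`stub_goodReduction` (good reduction) to the full informal content of the census memo QTQ1 §1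
("good SUPERSINGULAR reduction, `a_w = 0`, `#Ẽ_w(𝔽₃) = 4`"), which is the local input the route's K1
(signed Iwasawa theory at the good supersingular place `w`, `a_w = 0`) is designed around. The crux itself
stays OPEN; BSD is not proved by any of this.

WHAT.
* `natCard_point_reductionAt_of_valuation_lt_one`, `frobeniusTraceAt_eq_zero_of_valuation_lt_one` — over any
  number field: a `v`-integral model with `v(a₁), v(a₂), v(a₃), v(a₆) > 0` and unit discriminant reduces to
  `y² = x³ + ā₄x`, so for `#k_v ≡ 3 (mod 4)` it has `#k_v + 1` points (Ireland–Rosen Ch. 18 §4 Thm. 5; the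
  chosen minimal model has equally many points, Silverman VII.1.3(b)), i.e. `a_v = 0`.
* `frobeniusTraceAt_baseChange_eq_zero_of_padicValRat` — the tame descent of
  `hasGoodReductionAt_baseChange_of_padicValRat` with STRICT inequalities `i·k < e·ord_p aᵢ` (`i = 1, 2, 3, 6`):
  at every `w ∋ p` with `e(w|p) = e` and `#k_w ≡ 3 (mod 4)` of every number field `L`, `a_w(W ⊗ L) = 0`.
* `frobeniusTraceAt_baseChange_eq_zero_of_subTprime`, `natCard_point_reductionAt_baseChange_of_subTprime` — for
  `W/ℚ` globally minimal, elliptic, additive at `3` of census class (t′): `a_w(W ⊗ L) = 0` and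
  `#Ẽ_w(k_w) = #k_w + 1` at every `w ∣ 3` with `e(w|3) = 4` and ODD residue degree of every number field `L`
  (the rational model of `exists_rat_model_of_subTprime` has `i·k ≤ 4·ord₃ aᵢ` with `k ∈ {1, 3}` odd, hence
  `<` for `i ≠ 4`; `#k_w = 3^f ≡ 3 (mod 4)`).
* `frobeniusTraceAt_baseChange_eq_zero_of_subTprime_of_finrank_eq_four` — the route's shape: `[L : ℚ] = 4` and
  `e(w|3) = 4` force `f(w|3) = 1`, so `a_w = 0` and `#Ẽ_w(𝔽₃) = 4` (census QTQ1: 70/70 cells).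

References: J. H. Silverman, *AEC* VII.1 (Remark 1.1, Prop. 1.3(b)), VII.5.1(a), V.4 (Ex. 4.5), C.§16;
K. Ireland, M. Rosen, *A Classical Introduction to Modern Number Theory*, Ch. 18 §4 Thm. 5;
J.-P. Serre, J. Tate, Ann. of Math. 88 (1968) §2.
-/

-- D-0017: single-problem summit, so `Summit.BirchSwinnertonDyer.BirchSwinnertonDyer.…` repeats a namespace BY DESIGN.
set_option linter.dupNamespace false

noncomputable section

open scoped NumberField Classical

open IsDedekindDomain IsDedekindDomain.HeightOneSpectrum NumberField WeierstrassCurve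
  Literature.NumberTheory.EllipticCurves Literature.NumberTheory.EllipticCurves.Rank1Residual
  Summit.BirchSwinnertonDyer.Rank1Residual.Additive

namespace Summit.BirchSwinnertonDyer.BirchSwinnertonDyer.Theorems.SolventPairLowerBound

/-! ## §1 Point count of a `v`-integral model reducing to `y² = x³ + ā₄ x` -/

section ShortForm

variable {K : Type} [Field K] [NumberField K] (X : WeierstrassCurve K) (v : HeightOneSpectrum (𝓞 K))

/-- The residue class of a `v`-integral element of valuation `< 1` vanishes. [folklore] -/
theorem residue_eq_zero_of_valuation_lt_one {x : K} {r : v.adicCompletionIntegers K}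
    (hr : algebraMap (v.adicCompletionIntegers K) (v.adicCompletion K) r = (x : v.adicCompletion K))
    (hx : v.valuation K x < 1) :
    IsLocalRing.residue (v.adicCompletionIntegers K) r = 0 := by
  rw [IsLocalRing.residue_eq_zero_iff, IsLocalRing.mem_maximalIdeal, mem_nonunits_iff,
    adicCompletionIntegers.isUnit_iff_valued_eq_one]
  have hval : Valued.v (r : v.adicCompletion K) = v.valuation K x := by
    rw [show (r : v.adicCompletion K) = (x : v.adicCompletion K) from hr,
      valuedAdicCompletion_eq_valuation']
  rw [hval]
  exact hx.ne

/-- **A `v`-integral Weierstrass model with `v(a₁), v(a₂), v(a₃), v(a₆) > 0` and unit discriminant has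
`#k_v + 1` points modulo `v` when `#k_v ≡ 3 (mod 4)`.** Its reduction is `y² = x³ + ā₄x` (elliptic, as the
discriminant is a unit), whose point count over a finite field of order `≡ 3 (mod 4)` is `q + 1`
(Ireland–Rosen Ch. 18 §4 Thm. 5); the chosen local minimal model (`reductionAt`) has the same number of
points (Silverman *AEC* VII.1.3(b)). [cite: IrelandRosen1990, Ch. 18 §4, Theorem 5]
[cite: SilvermanAEC2009, VII.1 Prop. 1.3(b) and VII.5 Prop. 5.1(a)] -/
theorem natCard_point_reductionAt_of_valuation_lt_one
    (h₁ : v.valuation K X.a₁ < 1) (h₂ : v.valuation K X.a₂ < 1) (h₃ : v.valuation K X.a₃ < 1)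
    (h₄ : v.valuation K X.a₄ ≤ 1) (h₆ : v.valuation K X.a₆ < 1) (hΔ : v.valuation K X.Δ = 1)
    (hq : Nat.card (𝓞 K ⧸ v.asIdeal) % 4 = 3) :
    Nat.card (X.reductionAt v).toAffine.Point = Nat.card (𝓞 K ⧸ v.asIdeal) + 1 := by
  have hcard : Nat.card (IsLocalRing.ResidueField (v.adicCompletionIntegers K)) =
      Nat.card (𝓞 K ⧸ v.asIdeal) :=
    IsDedekindDomain.HeightOneSpectrum.natCard_residueField_adicCompletionIntegers K v
  set R := v.adicCompletionIntegers K with hR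
  set Xv : WeierstrassCurve (v.adicCompletion K) := X.baseChange (v.adicCompletion K) with hXv
  have hint : X.IsIntegralAt v := X.isIntegralAt_of_valuation_le_one v h₁.le h₂.le h₃.le h₄ h₆.le
  haveI hintI : Xv.IsIntegral R := hint
  have hgood : Xv.HasGoodReduction R := X.hasGoodReduction_baseChange_of_valuation_Δ_eq_one v hint hΔ
  haveI : Xv.IsMinimal R := hgood.toIsMinimal
  have hΔX : X.Δ ≠ 0 := by
    intro h; rw [h, map_zero] at hΔ; exact zero_ne_one hΔ
  have hΔ0 : Xv.Δ ≠ 0 := by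
    rw [hXv, WeierstrassCurve.baseChange, WeierstrassCurve.map_Δ]
    exact (map_ne_zero_iff _ (algebraMap K (v.adicCompletion K)).injective).mpr hΔX
  -- the chosen minimal model and the given minimal equation have equally many points
  have h1 : Nat.card (X.reductionAt v).toAffine.Point = Nat.card (Xv.reduction R).toAffine.Point :=
    natCard_point_reduction_minimal Xv hΔ0
  rw [h1]
  -- the reduction of the given equation is `y² = x³ + ā₄ x`
  set R₀ := Xv.reduction R with hR₀
  haveI : R₀.IsElliptic := (hasGoodReduction_iff_isElliptic_reduction R).mp hgood
  have hcoef : ∀ {x : K} {r : R}, algebraMap R (v.adicCompletion K) r = algebraMap K _ x →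
      v.valuation K x < 1 → IsLocalRing.residue R r = 0 := fun {x r} hr hx ↦
    residue_eq_zero_of_valuation_lt_one v hr hx
  have ha₁ : R₀.a₁ = 0 := by
    rw [hR₀, WeierstrassCurve.reduction, map_a₁]
    exact hcoef (by rw [integralModel_a₁_eq]; rfl) h₁
  have ha₂ : R₀.a₂ = 0 := by
    rw [hR₀, WeierstrassCurve.reduction, map_a₂]
    exact hcoef (by rw [integralModel_a₂_eq]; rfl) h₂
  have ha₃ : R₀.a₃ = 0 := by
    rw [hR₀, WeierstrassCurve.reduction, map_a₃]
    exact hcoef (by rw [integralModel_a₃_eq]; rfl) h₃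
  have ha₆ : R₀.a₆ = 0 := by
    rw [hR₀, WeierstrassCurve.reduction, map_a₆]
    exact hcoef (by rw [integralModel_a₆_eq]; rfl) h₆
  haveI : R₀.IsShortNF := ⟨ha₁, ha₂, ha₃⟩
  letI : Fintype (IsLocalRing.ResidueField R) := Fintype.ofFinite _
  have hF : Fintype.card (IsLocalRing.ResidueField R) % 4 = 3 := by rw [Fintype.card_eq_nat_card, hcard]; exact hq
  rw [natCard_point_eq_card_add_one_of_card_mod_four R₀ ha₆ hF, Fintype.card_eq_nat_card, hcard]

/-- **`a_v = 0`** for a `v`-integral model with `v(a₁), v(a₂), v(a₃), v(a₆) > 0`, unit discriminant and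
`#k_v ≡ 3 (mod 4)`: `a_v = #k_v + 1 − #Ẽ_v(k_v)` (Silverman C.§16, tree `frobeniusTraceAt`) and
`#Ẽ_v(k_v) = #k_v + 1`. [cite: IrelandRosen1990, Ch. 18 §4, Theorem 5] [cite: SilvermanAEC2009, C.§16] -/
theorem frobeniusTraceAt_eq_zero_of_valuation_lt_one
    (h₁ : v.valuation K X.a₁ < 1) (h₂ : v.valuation K X.a₂ < 1) (h₃ : v.valuation K X.a₃ < 1)
    (h₄ : v.valuation K X.a₄ ≤ 1) (h₆ : v.valuation K X.a₆ < 1) (hΔ : v.valuation K X.Δ = 1)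
    (hq : Nat.card (𝓞 K ⧸ v.asIdeal) % 4 = 3) :
    X.frobeniusTraceAt v = 0 := by
  rw [frobeniusTraceAt_def, natCard_point_reductionAt_of_valuation_lt_one X v h₁ h₂ h₃ h₄ h₆ hΔ hq,
    IsDedekindDomain.HeightOneSpectrum.natCard_residueField_adicCompletionIntegers K v]
  push_cast; ring

end ShortForm

/-! ## §2 The tame descent with point count -/

section Descent

/-- **Tame descent with point count.** Let `W/ℚ` be elliptic, `p` prime, `e k : ℕ` with
`e · ord_p Δ(W) = 12 k`, `aᵢ(W) = 0` or `i k < e · ord_p aᵢ(W)` for `i = 1, 2, 3, 6`, and `a₄(W) = 0` or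
`4 k ≤ e · ord_p a₄(W)`. Then for every number field `L` and place `w ∋ p` with `e(w|p) = e` and
`#k_w ≡ 3 (mod 4)`: `a_w(W ⊗ L) = 0`. Indeed the rescaled model `X = (ϖ^k, 0, 0, 0) • W_L` (`ϖ` a
`w`-uniformiser) has `w(aᵢ(X)) = exp(ik − e·ord_p aᵢ) < 1` for `i ≠ 4`, `w(a₄(X)) ≤ 1`, `w(Δ(X)) = 1`
(`ord_w = e · ord_p` on `ℚ`, Mathlib `valuation_liesOver`), so `#X̃_w(k_w) = #k_w + 1`
(`natCard_point_reductionAt_of_valuation_lt_one`), and `a_w` is invariant under the change of variables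
(Silverman VII.1.3(b), C.§16; tree `WeierstrassCurve.frobeniusTraceAt_smul`).
[cite: SilvermanAEC2009, VII.1 Remark 1.1, Prop. VII.1.3(b) and C.§16] [cite: IrelandRosen1990, Ch. 18 §4, Theorem 5] -/
theorem frobeniusTraceAt_baseChange_eq_zero_of_padicValRat (W : WeierstrassCurve ℚ) [W.IsElliptic]
    (p : ℕ) [hp : Fact p.Prime] {e k : ℕ} (hΔ : (e : ℤ) * padicValRat p W.Δ = 12 * k)
    (h₁ : W.a₁ = 0 ∨ (k : ℤ) < e * padicValRat p W.a₁)
    (h₂ : W.a₂ = 0 ∨ 2 * (k : ℤ) < e * padicValRat p W.a₂)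
    (h₃ : W.a₃ = 0 ∨ 3 * (k : ℤ) < e * padicValRat p W.a₃)
    (h₄ : W.a₄ = 0 ∨ 4 * (k : ℤ) ≤ e * padicValRat p W.a₄)
    (h₆ : W.a₆ = 0 ∨ 6 * (k : ℤ) < e * padicValRat p W.a₆)
    (L : Type) [Field L] [NumberField L] (w : HeightOneSpectrum (𝓞 L))
    (hw : (p : 𝓞 L) ∈ w.asIdeal) (he : w.asIdeal.ramificationIdx ℤ = e)
    (hq : Nat.card (𝓞 L ⧸ w.asIdeal) % 4 = 3) :
    (W.baseChange L).frobeniusTraceAt w = 0 := by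
  classical
  -- the place of `ℤ` below `w` is `(p)`
  set v : HeightOneSpectrum ℤ := (Rat.HeightOneSpectrum.primesEquiv (R := ℤ)).symm ⟨p, hp.out⟩
    with hvdef
  have hv : Rat.HeightOneSpectrum.natGenerator v = p :=
    congrArg Subtype.val ((Rat.HeightOneSpectrum.primesEquiv (R := ℤ)).apply_symm_apply ⟨p, hp.out⟩)
  have hvspan : v.asIdeal = Ideal.span {(p : ℤ)} := by
    rw [Rat.HeightOneSpectrum.asIdeal_eq_span_natGenerator_int, hv]
  haveI hlies' : w.asIdeal.LiesOver (Ideal.span {(p : ℤ)}) := liesOver_span_of_natCast_mem p L w hw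
  haveI hlies : w.asIdeal.LiesOver v.asIdeal := by rw [hvspan]; exact hlies'
  haveI := w.isPrime
  have he' : v.asIdeal.ramificationIdx' w.asIdeal = e := by
    rw [Ideal.ramificationIdx'_eq_ramificationIdx _ _ v.ne_bot, he]
  -- `ord_w = e · ord_p` on `ℚ`
  have hval : ∀ x : ℚ, w.valuation L (algebraMap ℚ L x) = v.valuation ℚ x ^ e := fun x ↦ by
    rw [← valuation_liesOver (K := ℚ) L v w x, he']
  have hval' : ∀ {x : ℚ}, x ≠ 0 →
      w.valuation L (algebraMap ℚ L x) = WithZero.exp (-((e : ℤ) * padicValRat p x)) := fun {x} hx ↦ by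
    rw [hval, Rat.HeightOneSpectrum.valuation_eq_exp_neg_padicValRat v hx, hv, ← WithZero.exp_nsmul,
      nsmul_eq_mul, mul_neg]
  -- a `w`-uniformiser and the rescaled model
  obtain ⟨ϖ, hϖ⟩ := w.valuation_exists_uniformizer L
  have hϖ0 : ϖ ≠ 0 := by
    intro h0; rw [h0, map_zero] at hϖ; exact WithZero.exp_ne_zero hϖ.symm
  have hϖk0 : ϖ ^ k ≠ 0 := pow_ne_zero _ hϖ0
  set C : VariableChange L := ⟨Units.mk0 (ϖ ^ k) hϖk0, 0, 0, 0⟩ with hC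
  set X := C • W.baseChange L with hX
  have hCu : (↑C.u⁻¹ : L) = (ϖ ^ k)⁻¹ := by simp [hC]
  have hvu : ∀ i : ℕ, w.valuation L ((↑C.u⁻¹ : L) ^ i) = WithZero.exp ((i * k : ℕ) : ℤ) := fun i ↦ by
    rw [hCu, map_pow, map_inv₀, map_pow, hϖ, ← WithZero.exp_nsmul, ← WithZero.exp_neg,
      ← WithZero.exp_nsmul]
    congr 1
    simp only [nsmul_eq_mul]; push_cast; ring
  -- the coefficients of `X`
  have hXa₁ : X.a₁ = (↑C.u⁻¹ : L) ^ 1 * algebraMap ℚ L W.a₁ := by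
    rw [hX, variableChange_a₁]; simp [hC, WeierstrassCurve.baseChange]
  have hXa₂ : X.a₂ = (↑C.u⁻¹ : L) ^ 2 * algebraMap ℚ L W.a₂ := by
    rw [hX, variableChange_a₂]; simp [hC, WeierstrassCurve.baseChange]
  have hXa₃ : X.a₃ = (↑C.u⁻¹ : L) ^ 3 * algebraMap ℚ L W.a₃ := by
    rw [hX, variableChange_a₃]; simp [hC, WeierstrassCurve.baseChange]
  have hXa₄ : X.a₄ = (↑C.u⁻¹ : L) ^ 4 * algebraMap ℚ L W.a₄ := by
    rw [hX, variableChange_a₄]; simp [hC, WeierstrassCurve.baseChange]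
  have hXa₆ : X.a₆ = (↑C.u⁻¹ : L) ^ 6 * algebraMap ℚ L W.a₆ := by
    rw [hX, variableChange_a₆]; simp [hC, WeierstrassCurve.baseChange]
  have hXΔ : X.Δ = (↑C.u⁻¹ : L) ^ 12 * algebraMap ℚ L W.Δ := by
    rw [hX, variableChange_Δ, WeierstrassCurve.baseChange, map_Δ]
  -- valuations of the coefficients: `w(u^{-i} a) = exp(ik − e·ord_p a)`
  have hvcoef : ∀ (i : ℕ) {a : ℚ}, a ≠ 0 → w.valuation L ((↑C.u⁻¹ : L) ^ i * algebraMap ℚ L a) =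
      WithZero.exp ((i : ℤ) * k - e * padicValRat p a) := fun i {a} ha0 ↦ by
    rw [map_mul, hvu, hval' ha0, ← WithZero.exp_add, Nat.cast_mul, sub_eq_add_neg]
  have hcoef_lt : ∀ (i : ℕ) (a : ℚ), (a = 0 ∨ (i : ℤ) * k < e * padicValRat p a) →
      w.valuation L ((↑C.u⁻¹ : L) ^ i * algebraMap ℚ L a) < 1 := by
    intro i a ha
    rcases eq_or_ne a 0 with rfl | ha0
    · rw [map_zero, mul_zero, map_zero]; exact zero_lt_one
    rw [hvcoef i ha0, ← WithZero.exp_zero, WithZero.exp_lt_exp]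
    rcases ha with h | h
    · exact absurd h ha0
    · linarith
  have hcoef_le : ∀ (i : ℕ) (a : ℚ), (a = 0 ∨ (i : ℤ) * k ≤ e * padicValRat p a) →
      w.valuation L ((↑C.u⁻¹ : L) ^ i * algebraMap ℚ L a) ≤ 1 := by
    intro i a ha
    rcases eq_or_ne a 0 with rfl | ha0
    · rw [map_zero, mul_zero, map_zero]; exact zero_le
    rw [hvcoef i ha0, ← WithZero.exp_zero, WithZero.exp_le_exp]
    rcases ha with h | h
    · exact absurd h ha0
    · linarith
  have hX₁ : w.valuation L X.a₁ < 1 := by rw [hXa₁]; exact hcoef_lt 1 _ (by simpa using h₁)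
  have hX₂ : w.valuation L X.a₂ < 1 := by rw [hXa₂]; exact hcoef_lt 2 _ (by simpa using h₂)
  have hX₃ : w.valuation L X.a₃ < 1 := by rw [hXa₃]; exact hcoef_lt 3 _ (by simpa using h₃)
  have hX₄ : w.valuation L X.a₄ ≤ 1 := by rw [hXa₄]; exact hcoef_le 4 _ (by simpa using h₄)
  have hX₆ : w.valuation L X.a₆ < 1 := by rw [hXa₆]; exact hcoef_lt 6 _ (by simpa using h₆)
  have hXΔ1 : w.valuation L X.Δ = 1 := by
    rw [hXΔ, hvcoef 12 W.isUnit_Δ.ne_zero, ← WithZero.exp_zero]; congr 1; push_cast; linarith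
  -- `a_w(X) = 0` and `a_w` is an isomorphism invariant
  haveI : (W.baseChange L).IsElliptic := by
    rw [WeierstrassCurve.baseChange]; infer_instance
  haveI : X.IsElliptic := by rw [hX]; infer_instance
  have hX0 : X.frobeniusTraceAt w = 0 :=
    frobeniusTraceAt_eq_zero_of_valuation_lt_one X w hX₁ hX₂ hX₃ hX₄ hX₆ hXΔ1 hq
  have hgoodX : X.HasGoodReductionAt w :=
    X.hasGoodReductionAt_of_valuation_le_one_of_valuation_Δ_eq_one w hX₁.le hX₂.le hX₃.le hX₄ hX₆.le
      hXΔ1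
  have hgood : (W.baseChange L).HasGoodReductionAt w :=
    (hasGoodReductionAt_smul_iff_holds w (W.baseChange L) C).mp (by rw [← hX]; exact hgoodX)
  rw [← WeierstrassCurve.frobeniusTraceAt_smul (W.baseChange L) C w hgood, ← hX, hX0]

end Descent

/-! ## §3 The (t′) leaf at `3` -/

section Tprime

/-- `3 ^ f ≡ 3 (mod 4)` for odd `f`. [folklore] -/
theorem three_pow_mod_four_of_odd {f : ℕ} (hf : Odd f) : 3 ^ f % 4 = 3 := by
  obtain ⟨m, rfl⟩ := hf; rw [pow_succ, pow_mul, Nat.mul_mod, Nat.pow_mod]; norm_num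

/-- For a place `w ∣ 3` of a number field with ODD residue degree `f(w|3)`, `#k_w = 3^f ≡ 3 (mod 4)`
(`#(𝓞 L ⧸ w) = N w = 3^{f(w|3)}`, Mathlib `Ideal.absNorm_eq_pow_inertiaDeg'`). [folklore] -/
theorem natCard_quotient_mod_four_of_odd_inertiaDeg (L : Type) [Field L] [NumberField L]
    (w : HeightOneSpectrum (𝓞 L)) (h3 : ((3 : ℕ) : 𝓞 L) ∈ w.asIdeal) (hf : Odd (w.asIdeal.inertiaDeg ℤ)) :
    Nat.card (𝓞 L ⧸ w.asIdeal) % 4 = 3 := by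
  haveI : w.asIdeal.LiesOver (Ideal.span {((3 : ℕ) : ℤ)}) := liesOver_span_of_natCast_mem 3 L w h3
  haveI := w.isMaximal
  haveI : (Ideal.span {((3 : ℕ) : ℤ)}).IsMaximal :=
    Ideal.IsPrime.isMaximal ((Ideal.span_singleton_prime (by norm_num)).mpr (by norm_num)) (by simp)
  have hcard : Nat.card (𝓞 L ⧸ w.asIdeal) = 3 ^ w.asIdeal.inertiaDeg ℤ := by
    rw [← Submodule.cardQuot_apply, ← Ideal.absNorm_apply,
      Ideal.absNorm_eq_pow_inertiaDeg' w.asIdeal Nat.prime_three, Ideal.inertiaDeg'_eq_inertiaDeg]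
  rw [hcard]
  exact three_pow_mod_four_of_odd hf

variable (W : WeierstrassCurve ℚ) [W.IsElliptic] [W.IsGloballyMinimal]

/-- **`a_w = 0` on the (t′) leaf.** For `W/ℚ` globally minimal, elliptic, additive at `3` of census class
(t′) (`Addv W 3`, `Additive.SubTprime W 3`: tame, `e = 4`, Kodaira `III`/`III*`), every number field `L`
and every place `w ∣ 3` with `e(w|3) = 4` and odd residue degree `f(w|3)` (e.g. `f = 1`): the trace of
Frobenius of `W ⊗ L` at `w` vanishes, `a_w = 0` — the reduction is the supersingular curve `y² = x³ ± x`
over `k_w`. Proof: the rational model of `exists_rat_model_of_subTprime` has `ord₃ Δ = 3k`, `4·ord₃ aᵢ ≥ i k`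
with `k ∈ {1, 3}` ODD, hence `>` for `i = 1, 2, 3, 6`; apply `frobeniusTraceAt_baseChange_eq_zero_of_padicValRat`
(`e = 4`, `#k_w = 3^f ≡ 3 (mod 4)`) and transport along the change of variables (`frobeniusTraceAt_smul`,
`stub_goodReduction`). Serre–Tate picture (QTQ1 §1): `ρ(Frob_w)` is anti-diagonal in the `±i`-eigenbasis of tame
inertia, so `tr ρ(Frob_w) = 0`; census: `a_w = 0` on 70/70 cells.
[cite: SilvermanAEC2009, VII.1 Prop. 1.3(b), VII.5.1(a), C.§16] [cite: IrelandRosen1990, Ch. 18 §4, Theorem 5]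
[cite: SerreTate1968, §2 Cor. 2] -/
theorem frobeniusTraceAt_baseChange_eq_zero_of_subTprime (hadd : Addv W 3)
    (hsub : Summit.BirchSwinnertonDyer.Rank1Residual.Additive.SubTprime W 3)
    (L : Type) [Field L] [NumberField L] (w : HeightOneSpectrum (𝓞 L))
    (h3 : ((3 : ℕ) : 𝓞 L) ∈ w.asIdeal) (he : w.asIdeal.ramificationIdx ℤ = 4)
    (hf : Odd (w.asIdeal.inertiaDeg ℤ)) :
    (W.baseChange L).frobeniusTraceAt w = 0 := by
  have hq := natCard_quotient_mod_four_of_odd_inertiaDeg L w h3 hf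
  obtain ⟨C, k, hk, hΔ, h₁, h₂, h₃, h₄, h₆⟩ := exists_rat_model_of_subTprime W hadd hsub
  haveI : (C • W).IsElliptic := inferInstance
  -- `k` is odd, so the non-strict inequalities `i k ≤ 4 ord aᵢ` are strict for `i = 1, 2, 3, 6`
  have h₁' : (C • W).a₁ = 0 ∨ (k : ℤ) < 4 * padicValRat 3 (C • W).a₁ := by
    rcases h₁ with h | h
    · exact Or.inl h
    · right; rcases hk with rfl | rfl <;> omega
  have h₂' : (C • W).a₂ = 0 ∨ 2 * (k : ℤ) < 4 * padicValRat 3 (C • W).a₂ := by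
    rcases h₂ with h | h
    · exact Or.inl h
    · right; rcases hk with rfl | rfl <;> omega
  have h₃' : (C • W).a₃ = 0 ∨ 3 * (k : ℤ) < 4 * padicValRat 3 (C • W).a₃ := by
    rcases h₃ with h | h
    · exact Or.inl h
    · right; rcases hk with rfl | rfl <;> omega
  have h₆' : (C • W).a₆ = 0 ∨ 6 * (k : ℤ) < 4 * padicValRat 3 (C • W).a₆ := by
    rcases h₆ with h | h
    · exact Or.inl h
    · right; rcases hk with rfl | rfl <;> omega
  have hzero : ((C • W).baseChange L).frobeniusTraceAt w = 0 :=
    frobeniusTraceAt_baseChange_eq_zero_of_padicValRat (C • W) 3 (e := 4) (k := k)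
      (by rw [hΔ]; push_cast; ring) h₁' h₂' h₃' (by exact_mod_cast h₄) h₆' L w h3 he hq
  have hbc : (C • W).baseChange L = (C.map (algebraMap ℚ L)) • W.baseChange L := by
    rw [WeierstrassCurve.baseChange, ← map_variableChange]; rfl
  haveI : (W.baseChange L).IsElliptic := by
    rw [WeierstrassCurve.baseChange]; infer_instance
  rw [hbc, WeierstrassCurve.frobeniusTraceAt_smul (W.baseChange L) _ w
    (stub_goodReduction W hadd hsub L w h3 he)] at hzero
  exact hzero

/-- **`#Ẽ_w(k_w) = #k_w + 1` on the (t′) leaf** (point-count form of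
`frobeniusTraceAt_baseChange_eq_zero_of_subTprime`; for `f(w|3) = 1`: `#Ẽ_w(𝔽₃) = 4`, census QTQ1).
[cite: SilvermanAEC2009, C.§16] [cite: IrelandRosen1990, Ch. 18 §4, Theorem 5] -/
theorem natCard_point_reductionAt_baseChange_of_subTprime (hadd : Addv W 3)
    (hsub : Summit.BirchSwinnertonDyer.Rank1Residual.Additive.SubTprime W 3)
    (L : Type) [Field L] [NumberField L] (w : HeightOneSpectrum (𝓞 L))
    (h3 : ((3 : ℕ) : 𝓞 L) ∈ w.asIdeal) (he : w.asIdeal.ramificationIdx ℤ = 4)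
    (hf : Odd (w.asIdeal.inertiaDeg ℤ)) :
    Nat.card ((W.baseChange L).reductionAt w).toAffine.Point = Nat.card (𝓞 L ⧸ w.asIdeal) + 1 := by
  have h := frobeniusTraceAt_baseChange_eq_zero_of_subTprime W hadd hsub L w h3 he hf
  rw [frobeniusTraceAt_def,
    IsDedekindDomain.HeightOneSpectrum.natCard_residueField_adicCompletionIntegers L w] at h
  omega

/-- `e(w|p) · f(w|p) ≤ [L : ℚ]` for a place `w ∣ p` of a number field `L` (one term of the fundamental
identity `∑ e f = [L : ℚ]`, Mathlib `Ideal.sum_ramification_inertia_eq_finrank`). [folklore] -/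
theorem ramificationIdx_mul_inertiaDeg_le_finrank (L : Type) [Field L] [NumberField L]
    (w : HeightOneSpectrum (𝓞 L)) {p : ℕ} (hp : p.Prime) (hw : ((p : ℕ) : 𝓞 L) ∈ w.asIdeal) :
    w.asIdeal.ramificationIdx ℤ * w.asIdeal.inertiaDeg ℤ ≤ Module.finrank ℚ L := by
  classical
  haveI : Fact p.Prime := ⟨hp⟩
  set P : Ideal ℤ := Ideal.span {((p : ℕ) : ℤ)} with hP
  haveI : w.asIdeal.LiesOver P := liesOver_span_of_natCast_mem p L w hw
  haveI : P.IsPrime := (Ideal.span_singleton_prime (by exact_mod_cast hp.ne_zero)).mpr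
    (Nat.prime_iff_prime_int.mp hp)
  haveI := w.isPrime
  haveI : Finite (P.primesOver (𝓞 L)) := (Algebra.QuasiFinite.finite_primesOver P).to_subtype
  letI := Fintype.ofFinite (P.primesOver (𝓞 L))
  have hsum := Ideal.sum_ramification_inertia_eq_finrank P (𝓞 L)
  rw [RingOfIntegers.rank] at hsum
  rw [← hsum]
  exact Finset.single_le_sum
    (f := fun q : P.primesOver (𝓞 L) => q.1.ramificationIdx ℤ * q.1.inertiaDeg ℤ)
    (fun _ _ => Nat.zero_le _) (Finset.mem_univ ⟨w.asIdeal, inferInstance, inferInstance⟩)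

/-- **The route's shape: a quartic field totally ramified at `3`.** For `W/ℚ` on the (t′) leaf, a number
field `L` with `[L : ℚ] = 4` and a place `w ∣ 3` with `e(w|3) = 4` (e.g. `ℚ(3^{1/4})`, `ℚ((−3)^{1/4})`, or the
tame quartic solvent field `L″ = ℚ(√d)(√β)` of the route): `f(w|3) = 1` (`e f ≤ 4`), so `a_w(W ⊗ L) = 0` —
good SUPERSINGULAR reduction with `#Ẽ_w(𝔽₃) = 4` (census QTQ1: 70/70 cells).
[cite: SilvermanAEC2009, C.§16] [cite: SerreTate1968, §2 Cor. 2] -/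
theorem frobeniusTraceAt_baseChange_eq_zero_of_subTprime_of_finrank_eq_four (hadd : Addv W 3)
    (hsub : Summit.BirchSwinnertonDyer.Rank1Residual.Additive.SubTprime W 3)
    (L : Type) [Field L] [NumberField L] (hL : Module.finrank ℚ L = 4) (w : HeightOneSpectrum (𝓞 L))
    (h3 : ((3 : ℕ) : 𝓞 L) ∈ w.asIdeal) (he : w.asIdeal.ramificationIdx ℤ = 4) :
    (W.baseChange L).frobeniusTraceAt w = 0 ∧
      Nat.card ((W.baseChange L).reductionAt w).toAffine.Point = 4 := by
  have hef := ramificationIdx_mul_inertiaDeg_le_finrank L w Nat.prime_three h3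
  rw [he, hL] at hef
  haveI : w.asIdeal.LiesOver (Ideal.span {((3 : ℕ) : ℤ)}) := liesOver_span_of_natCast_mem 3 L w h3
  haveI := w.isMaximal
  haveI : (Ideal.span {((3 : ℕ) : ℤ)}).IsMaximal :=
    Ideal.IsPrime.isMaximal ((Ideal.span_singleton_prime (by norm_num)).mpr (by norm_num)) (by simp)
  have hf0 : w.asIdeal.inertiaDeg ℤ ≠ 0 := by
    rw [← Ideal.inertiaDeg'_eq_inertiaDeg (Ideal.span {((3 : ℕ) : ℤ)}) w.asIdeal]
    exact Ideal.inertiaDeg'_ne_zero _ _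
  have hf1 : w.asIdeal.inertiaDeg ℤ = 1 := by omega
  have hf : Odd (w.asIdeal.inertiaDeg ℤ) := by rw [hf1]; exact odd_one
  refine ⟨frobeniusTraceAt_baseChange_eq_zero_of_subTprime W hadd hsub L w h3 he hf, ?_⟩
  have hcard : Nat.card (𝓞 L ⧸ w.asIdeal) = 3 := by
    rw [← Submodule.cardQuot_apply, ← Ideal.absNorm_apply,
      Ideal.absNorm_eq_pow_inertiaDeg' w.asIdeal Nat.prime_three, Ideal.inertiaDeg'_eq_inertiaDeg, hf1,
      pow_one]
  rw [natCard_point_reductionAt_baseChange_of_subTprime W hadd hsub L w h3 he hf, hcard]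

end Tprime

end Summit.BirchSwinnertonDyer.BirchSwinnertonDyer.Theorems.SolventPairLowerBound

end
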